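import Mathlib
import Literature.NumberTheory.LFunctions.Zhang2022.Section7bDischarges
import Literature.NumberTheory.LFunctions.Zhang2022.Section7aStatements
import Literature.Analysis.SpecialFunctions.GammaProductBounds
import HarnessLib

/-!
# Zhang (2022), §7 p. 35 (tex L1920): the `m`-series `Σ_m (κ∗a₁)(m)ψ(m)m^{−s}` and `ϑ*(1−s)` on the
# line `σ = 3/2` — size and continuity (tools for `Z22:§7.u021`), kernel-checked

Topic `Literature/NumberTheory/LFunctions/Zhang2022` (Landau–Siegel audit tree; verdict-neutral).
Y. Zhang, *Discrete mean estimates and the Landau–Siegel zero*, arXiv:2211.02515v1 (2022)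
[Zhang2022LandauSiegel] — **an unrefereed manuscript under adjudication; nothing here asserts or
denies its Theorems 1–2.** Campaign D-0069 (discharge lane, layer L2); THEOREM-ONLY.

§7 p. 35 (tex L1917–1920), proof of Proposition 7.1, after (7.6):

> Assume `ψ (mod p) ∈ Ψ`. By (2.4), in the integral `I₁(ψ)`, the factor `Z(s,ψ)⁻¹` can be replaced
> by `τ(ψ̄)p^{s−1}ϑ*(1−s)`, and then, by a trivial bound for `ϑ*(1−s)ω(s)` on `σ = 3/2`, the segment
> `𝒥(1)` can be replaced by the line `σ = 3/2`, with negligible errors.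

This file: the two analytic factors of the modified integrand that are not finite sums —
the series `Σ_m (κ∗a₁)(m)ψ(m)m^{−s}` (the `LSeries` in `Section7bStatements.I1psi`/`I1line`) and
`ϑ*(1−s) = (2π)^{−s}Γ(s)e(−s/4)` ((5.5), `GammaFactor.varthetaStarOneSub`) — on `σ = 3/2`.
Companions: `Section7I1LineBounds.lean` (the whole integrand), `Section7I1Line.lean` (`Step7u021`).

| decl | content |
|---|---|
| `summable_tau_five` | `Σ_m τ₅(m)m^{−σ₀} < ∞` for `σ₀ > 1` (`= ζ(σ₀)⁵`; `τ₅` = the tree's `MeanSquareMajorant.tau 5`) |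
| `lseries_summable_and_norm_le` | on `Re s ≥ 5/4`: absolute convergence and `‖Σ_m (κ∗a₁)(m)ψ(m)m^{−s}‖ ≤ B·Σ_m τ₅(m)m^{−5/4}` for `‖a₁‖ ≤ B` (`|(κ∗a₁)(m)| ≤ Bτ₅(m)`: the tree's `Section7aStatements.norm_kconv_le_tau_five`) |
| `continuous_lseries_line` | `t ↦ Σ_m (κ∗a₁)(m)ψ(m)m^{−(3/2+it)}` is continuous (Mathlib `LSeries_differentiableOn`) |
| `norm_varthetaStar_le` | `|ϑ*(1−s)| ≤ 16π²(1+|t|)²` for `s = 3/2+it` (tree Γ-bound `norm_Gamma_le_of_mem_Icc`; continuity of `t ↦ ϑ*(1−(3/2+it))` is the tree's `Section7I1Kernel.continuous_varthetaStar`, sz-d03) |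

No fact beyond Mathlib and tree theorems (FACT-LIST F-09 Γ-bounds) is used.

## References

* Y. Zhang, arXiv:2211.02515v1 (2022), §7 (7.6) p. 35, tex L1917–1920; §5 (5.5).
  [cite: Zhang2022LandauSiegel, §7 (7.6) p.35]
-/

noncomputable section

open Complex Real MeasureTheory Set Filter

namespace Literature.NumberTheory.LFunctions.Zhang2022.Section7I1Line

open Skeleton Section7bStatements
open Literature.Analysis.SpecialFunctions (norm_Gamma_le_of_mem_Icc)

/-! ## `Σ_m τ₅(m)m^{−σ₀}` converges for `σ₀ > 1` -/

/-- The complex sequence `n ↦ (ζ n : ℂ)` of the coerced arithmetic function is Mathlib's `↗ζ`.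
[folklore] -/
private theorem zetaC_apply (n : ℕ) :
    (ArithmeticFunction.zeta : ArithmeticFunction ℂ) n = ((ArithmeticFunction.zeta n : ℕ) : ℂ) :=
  ArithmeticFunction.natCoe_apply

/-- `Σ ζ^{∗(k+1)}(n) n^{−s}` is summable for `Re s > 1`. [folklore] -/
private theorem LSeriesSummable_zeta_pow {s : ℂ} (hs : 1 < s.re) (k : ℕ) :
    LSeriesSummable (fun n => ((ArithmeticFunction.zeta : ArithmeticFunction ℂ) ^ (k + 1)) n) s := by
  have hζ : LSeriesSummable (fun n => (ArithmeticFunction.zeta : ArithmeticFunction ℂ) n) s := by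
    simp_rw [zetaC_apply]; exact ArithmeticFunction.LSeriesSummable_zeta_iff.mpr hs
  induction k with
  | zero => simpa [pow_one] using hζ
  | succ k ih =>
    rw [pow_succ]
    exact ArithmeticFunction.LSeriesSummable_mul ih hζ

/-- **`Σ_m τ₅(m)m^{−σ₀} < ∞` for `σ₀ > 1`** (the series is `ζ(σ₀)⁵`; `τ₅ = 𝟙^{∗5}` is the tree's
`MeanSquareMajorant.tau 5`) — the absolute-convergence input behind "`(κ∗a₁)(m) = O(τ₅(m))`"
and the "trivial bounds" on `σ = 3/2` of §7. [cite: Zhang2022LandauSiegel, §7 p. 35, tex L1903] -/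
theorem summable_tau_five {σ₀ : ℝ} (h : 1 < σ₀) :
    Summable (fun m : ℕ => MeanSquareMajorant.tau 5 m * (m : ℝ) ^ (-σ₀)) := by
  have hs : 1 < (σ₀ : ℂ).re := by simpa using h
  have hS := LSeriesSummable_zeta_pow hs 4
  have hterm : ∀ m : ℕ, ((MeanSquareMajorant.tau 5 m * (m : ℝ) ^ (-σ₀) : ℝ) : ℂ) =
      LSeries.term (fun n => ((ArithmeticFunction.zeta : ArithmeticFunction ℂ) ^ (4 + 1)) n)
        (σ₀ : ℂ) m := by
    intro m
    rcases Nat.eq_zero_or_pos m with rfl | hm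
    · simp
    · rw [LSeries.term_of_ne_zero hm.ne', ← MeanSquareMajorant.tau_ofReal_eq_pow_apply,
        Complex.ofReal_mul, Complex.ofReal_cpow (Nat.cast_nonneg m), Complex.ofReal_natCast,
        Complex.ofReal_neg, Complex.cpow_neg, div_eq_mul_inv]
  have hsumC : Summable fun m : ℕ => ((MeanSquareMajorant.tau 5 m * (m : ℝ) ^ (-σ₀) : ℝ) : ℂ) := by
    simp_rw [hterm]; exact hS
  exact Complex.summable_ofReal.mp hsumC

/-! ## The `m`-series `Σ_m (κ∗a₁)(m)ψ(m)m^{−s}` on `Re s ≥ 5/4` -/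

variable (c' : ℝ)

/-- **Absolute convergence and size of `Σ_m (κ∗a₁)(m)ψ(m)m^{−s}`** for `Re s ≥ 5/4` and `‖a₁‖ ≤ B`:
the series is `LSeriesSummable` and `‖Σ_m (κ∗a₁)(m)ψ(m)m^{−s}‖ ≤ B·Σ_m τ₅(m)m^{−5/4}`
(termwise `|(κ∗a₁)(m)| ≤ Bτ₅(m)`, the tree's `norm_kconv_le_tau_five`, and `m^{−Re s} ≤ m^{−5/4}`).
[cite: Zhang2022LandauSiegel, §7 p. 34, tex L1874] -/
theorem lseries_summable_and_norm_le {D : ℕ} (x : Chr D) {B : ℝ} {a₁ : ℕ → ℂ}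
    (ha : ∀ n, ‖a₁ n‖ ≤ B) {s : ℂ} (hs : 5 / 4 ≤ s.re) :
    LSeriesSummable (fun m => kappaConv c' D a₁ m * x.ψ (m : ZMod x.p)) s ∧
      ‖LSeries (fun m => kappaConv c' D a₁ m * x.ψ (m : ZMod x.p)) s‖ ≤
        B * ∑' m : ℕ, MeanSquareMajorant.tau 5 m * (m : ℝ) ^ (-(5 / 4 : ℝ)) := by
  have hB : 0 ≤ B := (norm_nonneg _).trans (ha 0)
  set f : ℕ → ℂ := fun m => kappaConv c' D a₁ m * x.ψ (m : ZMod x.p) with hf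
  set g : ℕ → ℝ := fun m => B * (MeanSquareMajorant.tau 5 m * (m : ℝ) ^ (-(5 / 4 : ℝ))) with hg
  have hgs : Summable g := (summable_tau_five (by norm_num : (1 : ℝ) < 5 / 4)).mul_left B
  have hterm : ∀ m : ℕ, ‖LSeries.term f s m‖ ≤ g m := by
    intro m
    rw [LSeries.norm_term_eq]
    split_ifs with hm
    · simp only [hg]
      exact mul_nonneg hB (mul_nonneg (MeanSquareMajorant.tau_nonneg 5 m)
        (Real.rpow_nonneg (Nat.cast_nonneg m) _))
    · have hm0 : 0 < m := Nat.pos_of_ne_zero hm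
      have hm1 : (1 : ℝ) ≤ m := by exact_mod_cast hm0
      have hfm : ‖f m‖ ≤ B * MeanSquareMajorant.tau 5 m := by
        simp only [hf]
        rw [norm_mul, kappaConv_eq_conv]
        calc ‖MeanSquareMajorant.conv (Skeleton.kappaZ c' D) a₁ m‖ * ‖x.ψ (m : ZMod x.p)‖
            ≤ B * MeanSquareMajorant.tau 5 m * 1 :=
              mul_le_mul (Section7aStatements.norm_kconv_le_tau_five c' ha m)
                (DirichletCharacter.norm_le_one _ _) (norm_nonneg _)
                (mul_nonneg hB (MeanSquareMajorant.tau_nonneg 5 m))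
          _ = B * MeanSquareMajorant.tau 5 m := mul_one _
      have hpow : (m : ℝ) ^ s.re ≥ (m : ℝ) ^ (5 / 4 : ℝ) :=
        Real.rpow_le_rpow_of_exponent_le hm1 hs
      have hpos : 0 < (m : ℝ) ^ (5 / 4 : ℝ) := Real.rpow_pos_of_pos (by exact_mod_cast hm0) _
      rw [div_eq_mul_inv]
      calc ‖f m‖ * ((m : ℝ) ^ s.re)⁻¹ ≤ (B * MeanSquareMajorant.tau 5 m) * ((m : ℝ) ^ (5 / 4 : ℝ))⁻¹ := by
            apply mul_le_mul hfm _ (by positivity) (mul_nonneg hB (MeanSquareMajorant.tau_nonneg 5 m))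
            exact inv_anti₀ hpos hpow
        _ = g m := by
            simp only [hg]; rw [Real.rpow_neg (Nat.cast_nonneg m)]; ring
  have hsum : LSeriesSummable f s :=
    Summable.of_norm_bounded hgs hterm
  refine ⟨hsum, ?_⟩
  have h := tsum_of_norm_bounded hgs.hasSum hterm
  rw [LSeries]
  refine h.trans_eq ?_
  simp only [hg]
  rw [tsum_mul_left]

/-- **Continuity of `t ↦ Σ_m (κ∗a₁)(m)ψ(m)m^{−(3/2+it)}`** (the `m`-series is holomorphic on
`Re s > 5/4 ≥` its abscissa of absolute convergence). [cite: Zhang2022LandauSiegel, §7 p. 35, tex L1920] -/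
theorem continuous_lseries_line {D : ℕ} (x : Chr D) {B : ℝ} {a₁ : ℕ → ℂ}
    (ha : ∀ n, ‖a₁ n‖ ≤ B) :
    Continuous fun t : ℝ =>
      LSeries (fun m => kappaConv c' D a₁ m * x.ψ (m : ZMod x.p)) ((3 / 2 : ℂ) + t * I) := by
  set f : ℕ → ℂ := fun m => kappaConv c' D a₁ m * x.ψ (m : ZMod x.p) with hf
  have h54 : LSeriesSummable f ((5 / 4 : ℝ) : ℂ) :=
    (lseries_summable_and_norm_le c' x ha (s := ((5 / 4 : ℝ) : ℂ)) (by simp)).1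
  have habs : LSeries.abscissaOfAbsConv f ≤ ((5 / 4 : ℝ) : EReal) := by
    have := h54.abscissaOfAbsConv_le
    simpa using this
  have hdiff := LSeries_differentiableOn f
  have hline : Continuous fun t : ℝ => (3 / 2 : ℂ) + (t : ℂ) * I := by fun_prop
  have hmaps : ∀ t : ℝ, (3 / 2 : ℂ) + (t : ℂ) * I ∈ {s : ℂ | LSeries.abscissaOfAbsConv f < s.re} := by
    intro t
    simp only [Set.mem_setOf_eq]
    have hre : ((3 / 2 : ℂ) + (t : ℂ) * I).re = (3 / 2 : ℝ) := by simp
    rw [hre]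
    exact lt_of_le_of_lt habs (by exact_mod_cast (by norm_num : (5 / 4 : ℝ) < 3 / 2))
  exact hdiff.continuousOn.comp_continuous hline hmaps

/-! ## `ϑ*(1−s) = (2π)^{−s}Γ(s)e(−s/4)` on `σ = 3/2` -/

/-- **"A trivial bound for `ϑ*(1−s)` on `σ = 3/2`"**: `‖ϑ*(1−s)‖ ≤ 16π²(1+|t|)²` for `s = 3/2 + it`,
every real `t` (`|(2π)^{−s}| = (2π)^{−3/2} ≤ 1`, `|Γ(3/2+it)| ≤ 16π²(1+|t|)^{3/2}e^{−π|t|/2}`,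
`|e(−s/4)| = e^{πt/2}`). [cite: Zhang2022LandauSiegel, §7 p. 35, tex L1920] -/
theorem norm_varthetaStar_le (t : ℝ) :
    ‖GammaFactor.varthetaStarOneSub ((3 / 2 : ℂ) + t * I)‖ ≤ 16 * π ^ 2 * (1 + |t|) ^ 2 := by
  have hπ := Real.pi_pos
  have hπ3 := Real.pi_gt_three
  rw [GammaFactor.varthetaStarOneSub, norm_mul, norm_mul]
  -- `|(2π)^{−s}| ≤ 1`
  have h1 : ‖(2 * π : ℂ) ^ (-((3 / 2 : ℂ) + t * I))‖ ≤ 1 := by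
    rw [SiegelIntegral.norm_two_pi_cpow]
    apply Real.rpow_le_one_of_one_le_of_nonpos (by linarith)
    have : (-((3 / 2 : ℂ) + t * I)).re = -(3 / 2) := by simp
    rw [this]; norm_num
  -- `|Γ(3/2+it)|`
  have h2 : ‖Complex.Gamma ((3 / 2 : ℂ) + t * I)‖ ≤
      16 * π ^ 2 * (1 + |t|) ^ (3 / 2 : ℝ) * Real.exp (-(π * |t|) / 2) := by
    have h := norm_Gamma_le_of_mem_Icc (x := 3 / 2) (by norm_num) (by norm_num) t
    have e : (((3 / 2 : ℝ)) : ℂ) + (t : ℂ) * I = (3 / 2 : ℂ) + t * I := by push_cast; ring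
    rwa [e] at h
  -- `|e(−s/4)| = e^{πt/2}`
  have h3 : ‖cexp (-(π * ((3 / 2 : ℂ) + t * I) / 2) * I)‖ = Real.exp (π * t / 2) := by
    rw [Complex.norm_exp]
    congr 1
    simp [Complex.mul_re, Complex.mul_im]
  have hpow : (1 + |t|) ^ (3 / 2 : ℝ) ≤ (1 + |t|) ^ 2 := by
    have h1t : (1 : ℝ) ≤ 1 + |t| := by linarith [abs_nonneg t]
    calc (1 + |t|) ^ (3 / 2 : ℝ) ≤ (1 + |t|) ^ ((2 : ℕ) : ℝ) :=
          Real.rpow_le_rpow_of_exponent_le h1t (by norm_num)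
      _ = (1 + |t|) ^ 2 := Real.rpow_natCast _ _
  have hexp : Real.exp (-(π * |t|) / 2) * Real.exp (π * t / 2) ≤ 1 := by
    rw [← Real.exp_add]
    apply Real.exp_le_one_iff.mpr
    have : t ≤ |t| := le_abs_self t
    nlinarith
  have hE1 : 0 ≤ Real.exp (-(π * |t|) / 2) := (Real.exp_pos _).le
  have hE2 : 0 ≤ Real.exp (π * t / 2) := (Real.exp_pos _).le
  rw [h3]
  calc ‖(2 * π : ℂ) ^ (-((3 / 2 : ℂ) + t * I))‖ * ‖Complex.Gamma ((3 / 2 : ℂ) + t * I)‖ *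
        Real.exp (π * t / 2)
      ≤ 1 * (16 * π ^ 2 * (1 + |t|) ^ (3 / 2 : ℝ) * Real.exp (-(π * |t|) / 2)) *
          Real.exp (π * t / 2) := by gcongr
    _ = 16 * π ^ 2 * (1 + |t|) ^ (3 / 2 : ℝ) * (Real.exp (-(π * |t|) / 2) * Real.exp (π * t / 2)) := by
        ring
    _ ≤ 16 * π ^ 2 * (1 + |t|) ^ 2 * 1 := by gcongr
    _ = 16 * π ^ 2 * (1 + |t|) ^ 2 := mul_one _

end Literature.NumberTheory.LFunctions.Zhang2022.Section7I1Line
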